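import Summits.Ventures.WeilGRH.DualTrigKernelFamily
import Summits.Ventures.WeilGRH.DualTrigKernelTail2
import Summits.Ventures.WeilGRH.WeilPrimeRippleBounds
import HarnessLib

/-!
# Format D-K soundness, part 10: PARTIAL keys and UNIVERSAL (archimedean-only) certificates

Cell `rh-explicit`, WEIL TRACK — GRH ARM, route B (weil-grh-3).  A format-D-K certificate `c` lists the
character values on its OWN window `n ≤ c.N` and certifies, at the threshold modulus `c.q`,

  `0 ≤ Re ψ(1/4 + a/2 + iτ/2) + (log c.q − log π) − ρ_{χ,c.N}(τ) + T(τ)`   (`T` = the atoms)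

for every real `τ`, so that at a modulus `q` the multiplier inequality holds with slack `log q − log c.q`
(`DKCert.le_sound_threshold`).  On a LARGER window `N' ≥ c.N` the twisted prime ripple of ANY
Dirichlet character differs from `ρ_{χ,c.N}` by the unlisted prime powers `c.N < n ≤ N'`, each bounded
trivially (`‖χ(n)‖ ≤ 1`, one step at a time: `abs_weilPrimeRippleChar_succ_sub_le`, with the vanishing
cases `(n, q) > 1` and `n` not a prime power):

  `|ρ_{χ,N'}(τ) − ρ_{χ,c.N}(τ)| ≤ B := Σ_{c.N < n ≤ N', n a prime power, (n, q) = 1} 2Λ(n)/√n`.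

Hence (`DKCert.sound_partial`, `DKCert.weilPositivityOnChar_partial_of_check`): if the atoms are
admissible for the larger window (`p₀^k ≥ (N'+1)^D`, a decidable condition on the data) and
`log c.q + B ≤ log q`, then `WeilPositivityOnChar χ (log (N'+1) / 2)` for EVERY character `χ` mod `q`
with the certificate's parity and the listed values on `n ≤ c.N` — the unlisted values `χ(n)`,
`c.N < n ≤ N'`, are FREE.  Two extreme cases: `N' = c.N`, `B = 0` is the key-group family theorem of
`DualTrigKernelFamily.lean`; `c.N = 1` (empty window: an ARCHIMEDEAN-ONLY certificate) gives a UNIVERSAL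
rung — every character of parity `a` and conductor `log q ≥ log c.q + B_{N'}(q)`, with no arithmetic
hypothesis at all (`DKCert.weilPositivityOnChar_universal_of_check`).  The same from `check2`
(`DualTrigKernelTail2.lean`).  Numeric values of the coefficients `2Λ(n)/√n`, `2 ≤ n ≤ 9`, are recorded
for the instance files.  Everything here is PROVED; no named facts, no `sorry`, no kernel evaluation.

## References

* A. Weil, *Sur les "formules explicites" de la théorie des nombres premiers*, Comm. Sém. Math. Univ.
  Lund, tome suppl. (1952), (11) pp. 261–262 (the prime-power terms carry `χ(𝔭)ⁿ`, `|χ| ≤ 1`).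
  [folklore consequences]
-/

noncomputable section

open Finset Real Complex

namespace Summit.Ventures.WeilGRH

open Literature.Analysis.ValidatedNumerics.NumericsMP
open Literature.NumberTheory.LFunctions
open scoped ArithmeticFunction.vonMangoldt

namespace DKCert

variable {c : DKCert}

/-! ### The certified inequality at the threshold modulus, with the slack made explicit -/

/-- **The certified inequality with its conductor slack.**  If `c.check = true` then for every modulus
`q` and every Dirichlet character `χ` mod `q` of parity `c.par` with the listed window values (and
`χ(n) = 0` at the prime powers `n ≤ c.N` not coprime to `c.q`):
`log q − log c.q ≤ M_{χ,c.N}(τ) + T(τ)` for every real `τ`. [folklore] -/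
theorem le_sound_threshold (hc : c.check = true) {q : ℕ} (χ : DirichletCharacter ℂ q)
    (hpar : charParity χ = c.par) (hχ : ∀ val ∈ c.vals, χ (val.n : ZMod q) = valZ val)
    (hχ0 : ∀ n : ℕ, n ≤ c.N → IsPrimePow n → ¬ Nat.Coprime n c.q → χ (n : ZMod q) = 0) (τ : ℝ) :
    Real.log q - Real.log c.q ≤ weilFinitePrimeWeightChar χ c.N τ + trigSum (c.atoms.map c.atomT) τ := by
  have hmain := Pθ_nonneg_of_check hc (c.omegaR * τ)
  unfold check frameOK at hc
  simp only [Bool.and_eq_true] at hc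
  obtain ⟨⟨⟨⟨⟨⟨hconsts, hvals⟩, hnodup⟩, _⟩, _⟩, _⟩, _⟩ := hc
  obtain ⟨_, hp0, hD, _, _, _, _, _, _, _⟩ := constsOK_sound hconsts
  obtain ⟨_, hρω⟩ := rhoR_pos_and_mul hp0 hD
  unfold Pθ at hmain
  have hval := sumVal_valsR_eq_family (χ := χ) hp0 hD hvals (by
    unfold valsNodup at hnodup; simpa using hnodup) hχ hχ0 τ
  unfold termsR at hmain
  rw [sumVal_append, sumVal_atoms, hval] at hmain
  unfold weilFinitePrimeWeightChar
  have harg : (c.sigR : ℂ) + ((c.rhoR * (c.omegaR * τ) : ℝ) : ℂ) * I =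
      1 / 4 + (charParity χ : ℂ) / 2 + (τ : ℂ) / 2 * I := by
    rw [← mul_assoc, hρω, hpar]
    unfold sigR
    push_cast; ring
  rw [harg] at hmain
  unfold constR at hmain
  linarith

/-- The same from `check2`. [folklore] -/
theorem le_sound_threshold2 (hc : c.check2 = true) {q : ℕ} (χ : DirichletCharacter ℂ q)
    (hpar : charParity χ = c.par) (hχ : ∀ val ∈ c.vals, χ (val.n : ZMod q) = valZ val)
    (hχ0 : ∀ n : ℕ, n ≤ c.N → IsPrimePow n → ¬ Nat.Coprime n c.q → χ (n : ZMod q) = 0) (τ : ℝ) :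
    Real.log q - Real.log c.q ≤ weilFinitePrimeWeightChar χ c.N τ + trigSum (c.atoms.map c.atomT) τ := by
  have hmain := Pθ_nonneg_of_check2 hc (c.omegaR * τ)
  unfold check2 frameOK2 at hc
  simp only [Bool.and_eq_true] at hc
  obtain ⟨⟨⟨⟨⟨⟨hconsts, hvals⟩, hnodup⟩, _⟩, _⟩, _⟩, _⟩ := hc
  obtain ⟨_, hp0, hD, _, _, _, _, _, _, _⟩ := constsOK_sound hconsts
  obtain ⟨_, hρω⟩ := rhoR_pos_and_mul hp0 hD
  unfold Pθ at hmain
  have hval := sumVal_valsR_eq_family (χ := χ) hp0 hD hvals (by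
    unfold valsNodup at hnodup; simpa using hnodup) hχ hχ0 τ
  unfold termsR at hmain
  rw [sumVal_append, sumVal_atoms, hval] at hmain
  unfold weilFinitePrimeWeightChar
  have harg : (c.sigR : ℂ) + ((c.rhoR * (c.omegaR * τ) : ℝ) : ℂ) * I =
      1 / 4 + (charParity χ : ℂ) / 2 + (τ : ℂ) / 2 * I := by
    rw [← mul_assoc, hρω, hpar]
    unfold sigR
    push_cast; ring
  rw [harg] at hmain
  unfold constR at hmain
  linarith

/-! ### Partial keys: a larger window, the unlisted prime powers bounded trivially -/

/-- The weights on two windows differ by the ripples only: `M_{χ,N'} = M_{χ,N} − (ρ_{χ,N'} − ρ_{χ,N})`.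
[folklore] -/
theorem weilFinitePrimeWeightChar_window {q : ℕ} (χ : DirichletCharacter ℂ q) (N N' : ℕ) (τ : ℝ) :
    weilFinitePrimeWeightChar χ N' τ =
      weilFinitePrimeWeightChar χ N τ - (weilPrimeRippleChar χ N' τ - weilPrimeRippleChar χ N τ) := by
  unfold weilFinitePrimeWeightChar; ring

/-- **Soundness on a larger window (partial key).**  If `c.check = true`, `χ` mod `q` has parity `c.par`
and the listed values on the certificate's window `n ≤ c.N`, the ripple difference to the window `N'`
is bounded by `B`, and `log c.q + B ≤ log q`, then `0 ≤ M_{χ,N'}(τ) + T(τ)` for every real `τ`.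
[folklore] -/
theorem sound_partial (hc : c.check = true) {q : ℕ} (χ : DirichletCharacter ℂ q)
    (hpar : charParity χ = c.par) (hχ : ∀ val ∈ c.vals, χ (val.n : ZMod q) = valZ val)
    (hχ0 : ∀ n : ℕ, n ≤ c.N → IsPrimePow n → ¬ Nat.Coprime n c.q → χ (n : ZMod q) = 0)
    {N' : ℕ} {B : ℝ} (hB : ∀ τ : ℝ, weilPrimeRippleChar χ N' τ - weilPrimeRippleChar χ c.N τ ≤ B)
    (hlog : Real.log c.q + B ≤ Real.log q) (τ : ℝ) :
    0 ≤ weilFinitePrimeWeightChar χ N' τ + trigSum (c.atoms.map c.atomT) τ := by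
  have h := le_sound_threshold hc χ hpar hχ hχ0 τ
  rw [weilFinitePrimeWeightChar_window χ c.N N' τ]
  linarith [hB τ]

/-- The same from `check2`. [folklore] -/
theorem sound_partial2 (hc : c.check2 = true) {q : ℕ} (χ : DirichletCharacter ℂ q)
    (hpar : charParity χ = c.par) (hχ : ∀ val ∈ c.vals, χ (val.n : ZMod q) = valZ val)
    (hχ0 : ∀ n : ℕ, n ≤ c.N → IsPrimePow n → ¬ Nat.Coprime n c.q → χ (n : ZMod q) = 0)
    {N' : ℕ} {B : ℝ} (hB : ∀ τ : ℝ, weilPrimeRippleChar χ N' τ - weilPrimeRippleChar χ c.N τ ≤ B)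
    (hlog : Real.log c.q + B ≤ Real.log q) (τ : ℝ) :
    0 ≤ weilFinitePrimeWeightChar χ N' τ + trigSum (c.atoms.map c.atomT) τ := by
  have h := le_sound_threshold2 hc χ hpar hχ hχ0 τ
  rw [weilFinitePrimeWeightChar_window χ c.N N' τ]
  linarith [hB τ]

/-- Admissibility of the atoms for a window `N'` from the decidable condition `p₀^k ≥ (N'+1)^D` on the
data (given `2 ≤ p₀`, `1 ≤ D`): every atom frequency `k ω` is `≥ log (N'+1)`. [folklore] -/
theorem atoms_admissible (hp0 : 2 ≤ c.p0) (hD : 1 ≤ c.D) {N' : ℕ}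
    (hadm : (c.atoms.all fun atm => decide ((N' + 1) ^ c.D ≤ c.p0 ^ atm.k)) = true) :
    ∀ A ∈ c.atoms.map c.atomT, Real.log ((N' : ℝ) + 1) ≤ A.x := by
  intro A hA
  rw [List.mem_map] at hA
  obtain ⟨atm, hatm, rfl⟩ := hA
  rw [List.all_eq_true] at hadm
  have h := hadm atm hatm
  rw [decide_eq_true_eq] at h
  simp only [atomT, omegaR]
  have hp0r : (1 : ℝ) < c.p0 := by exact_mod_cast hp0
  have hDr : (0 : ℝ) < c.D := by exact_mod_cast hD
  have hN1 : (0 : ℝ) < (N' : ℝ) + 1 := by positivity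
  have hreal : ((N' : ℝ) + 1) ^ c.D ≤ (c.p0 : ℝ) ^ atm.k := by exact_mod_cast h
  have hlogle := Real.log_le_log (by positivity) hreal
  rw [Real.log_pow, Real.log_pow] at hlogle
  rw [← mul_div_assoc, le_div_iff₀ hDr]
  linarith

/-- **The rung on a larger window (partial key), every conductor above the threshold.**  If
`c.check = true`, the atoms are admissible for the window `N'` (`p₀^k ≥ (N'+1)^D` for every atom), `χ`
mod `q ≠ 1` has parity `c.par` and the certificate's listed values on `n ≤ c.N` (and vanishes at the prime
powers `n ≤ c.N` not coprime to `c.q`), the ripple difference `ρ_{χ,N'} − ρ_{χ,c.N}` is bounded by `B`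
and `log c.q + B ≤ log q`: then `WeilPositivityOnChar χ (log (N'+1) / 2)` — the values `χ(n)`,
`c.N < n ≤ N'`, are NOT constrained. [folklore] -/
theorem weilPositivityOnChar_partial_of_check (hc : c.check = true) {N' : ℕ}
    (hadm : (c.atoms.all fun atm => decide ((N' + 1) ^ c.D ≤ c.p0 ^ atm.k)) = true)
    {q : ℕ} (hq1 : q ≠ 1) (χ : DirichletCharacter ℂ q) (hpar : charParity χ = c.par)
    (hχ : ∀ val ∈ c.vals, χ (val.n : ZMod q) = valZ val)
    (hχ0 : ∀ n : ℕ, n ≤ c.N → IsPrimePow n → ¬ Nat.Coprime n c.q → χ (n : ZMod q) = 0)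
    {B : ℝ} (hB : ∀ τ : ℝ, weilPrimeRippleChar χ N' τ - weilPrimeRippleChar χ c.N τ ≤ B)
    (hlog : Real.log c.q + B ≤ Real.log q) :
    WeilPositivityOnChar χ (Real.log ((N' : ℝ) + 1) / 2) := by
  have hc' := hc
  unfold check frameOK at hc'
  simp only [Bool.and_eq_true] at hc'
  obtain ⟨⟨⟨⟨⟨⟨hconsts, _⟩, _⟩, _⟩, _⟩, _⟩, _⟩ := hc'
  obtain ⟨_, hp0, hD, -⟩ := constsOK_sound hconsts
  exact weilPositivityOnChar_of_trigDual hq1 χ N' (c.atoms.map c.atomT) (atoms_admissible hp0 hD hadm)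
    (sound_partial hc χ hpar hχ hχ0 hB hlog)

/-- The same from `check2`. [folklore] -/
theorem weilPositivityOnChar_partial_of_check2 (hc : c.check2 = true) {N' : ℕ}
    (hadm : (c.atoms.all fun atm => decide ((N' + 1) ^ c.D ≤ c.p0 ^ atm.k)) = true)
    {q : ℕ} (hq1 : q ≠ 1) (χ : DirichletCharacter ℂ q) (hpar : charParity χ = c.par)
    (hχ : ∀ val ∈ c.vals, χ (val.n : ZMod q) = valZ val)
    (hχ0 : ∀ n : ℕ, n ≤ c.N → IsPrimePow n → ¬ Nat.Coprime n c.q → χ (n : ZMod q) = 0)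
    {B : ℝ} (hB : ∀ τ : ℝ, weilPrimeRippleChar χ N' τ - weilPrimeRippleChar χ c.N τ ≤ B)
    (hlog : Real.log c.q + B ≤ Real.log q) :
    WeilPositivityOnChar χ (Real.log ((N' : ℝ) + 1) / 2) := by
  have hc' := hc
  unfold check2 frameOK2 at hc'
  simp only [Bool.and_eq_true] at hc'
  obtain ⟨⟨⟨⟨⟨⟨hconsts, _⟩, _⟩, _⟩, _⟩, _⟩, _⟩ := hc'
  obtain ⟨_, hp0, hD, -⟩ := constsOK_sound hconsts
  exact weilPositivityOnChar_of_trigDual hq1 χ N' (c.atoms.map c.atomT) (atoms_admissible hp0 hD hadm)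
    (sound_partial2 hc χ hpar hχ hχ0 hB hlog)

/-! ### Universal (archimedean-only) certificates: `c.N = 1`, no listed values -/

/-- **UNIVERSAL RUNG from an archimedean-only certificate.**  If `c.check = true` with the EMPTY
window `c.N = 1` (so `c.vals = []` and the certificate certifies
`0 ≤ Re ψ(1/4 + a/2 + iτ/2) + log c.q − log π + T(τ)` on `ℝ`), the atoms are admissible for the window
`N'`, and `χ` is ANY Dirichlet character mod `q ≠ 1` of parity `c.par` whose ripple on the window `N'`
is bounded by `B` with `log c.q + B ≤ log q`, then `WeilPositivityOnChar χ (log (N'+1) / 2)`.  With the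
trivial bound `B = Σ_{n ≤ N', (n,q) = 1} 2Λ(n)/√n` this is a rung for EVERY character of parity `c.par`
of every conductor `q ≥ c.q · e^{B}` — no arithmetic hypothesis. [folklore] -/
theorem weilPositivityOnChar_universal_of_check (hc : c.check = true) (hN : c.N = 1) (hv : c.vals = [])
    {N' : ℕ} (hadm : (c.atoms.all fun atm => decide ((N' + 1) ^ c.D ≤ c.p0 ^ atm.k)) = true)
    {q : ℕ} (hq1 : q ≠ 1) (χ : DirichletCharacter ℂ q) (hpar : charParity χ = c.par)
    {B : ℝ} (hB : ∀ τ : ℝ, weilPrimeRippleChar χ N' τ ≤ B) (hlog : Real.log c.q + B ≤ Real.log q) :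
    WeilPositivityOnChar χ (Real.log ((N' : ℝ) + 1) / 2) := by
  refine weilPositivityOnChar_partial_of_check hc hadm hq1 χ hpar (by rw [hv]; simp) ?_ (B := B) ?_ hlog
  · intro n hn hpp _
    exfalso
    rw [hN] at hn
    have := hpp.two_le
    omega
  · intro τ
    rw [hN, weilPrimeRippleChar_one, sub_zero]
    exact hB τ

/-- The same from `check2`. [folklore] -/
theorem weilPositivityOnChar_universal_of_check2 (hc : c.check2 = true) (hN : c.N = 1) (hv : c.vals = [])
    {N' : ℕ} (hadm : (c.atoms.all fun atm => decide ((N' + 1) ^ c.D ≤ c.p0 ^ atm.k)) = true)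
    {q : ℕ} (hq1 : q ≠ 1) (χ : DirichletCharacter ℂ q) (hpar : charParity χ = c.par)
    {B : ℝ} (hB : ∀ τ : ℝ, weilPrimeRippleChar χ N' τ ≤ B) (hlog : Real.log c.q + B ≤ Real.log q) :
    WeilPositivityOnChar χ (Real.log ((N' : ℝ) + 1) / 2) := by
  refine weilPositivityOnChar_partial_of_check2 hc hadm hq1 χ hpar (by rw [hv]; simp) ?_ (B := B) ?_ hlog
  · intro n hn hpp _
    exfalso
    rw [hN] at hn
    have := hpp.two_le
    omega
  · intro τ
    rw [hN, weilPrimeRippleChar_one, sub_zero]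
    exact hB τ

end DKCert

end Summit.Ventures.WeilGRH

end
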